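import Summits.ResolutionOfSingularities.ResolutionOfSingularities.Theorems.PurelyInseparableDim4AtlasZigzagSets
import Summits.ResolutionOfSingularities.ResolutionOfSingularities.Theorems.PurelyInseparableDim4AtlasZigzagTransport
import Summits.ResolutionOfSingularities.ResolutionOfSingularities.Theorems.PurelyInseparableDim4ChartZigzagShape
import Literature.AlgebraicGeometry.Resolution.NormalCrossingsLocal
import Literature.AlgebraicGeometry.Resolution.IdealSheafDescent
import HarnessLib

/-!
# Purely inseparable four-folds: the ATLAS CHILD from CHARTWISE MODEL DATA — the transported centre on the stage, closed, covered by
# the zigzag charts of the charts, with its readings (brick S3 (c) v4, tranche 1, brick A1-charts; cell `res-dim4-pi`)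

[OURS · counted 0] (D-0157 DOOR 2; host item stmt-ResolutionOfSingularities-16155, helper). Nothing here proves resolution of
singularities in dimension ≥ 4 / characteristic `p`. Steps (1)–(4) of the A1 architecture of `res-dim4-typ-3/S3c-V4-ATLAS-MEMBERS-DESIGN.md`
§10 with the re-centrings as INPUT (g6's `atlas_child_core`, p714367, hides them behind `∃ Θ`; the sequel — regularity, snc, owned cover,
fibre-closedness — needs the model charts themselves). SETTING: v3's zigzag `Z ←φ— Y —ψ→ 𝔸⁵`, `π : W → Z` ANY morphism with a comparison
`ε : π⁻¹φ(Y) ≅ B⁻¹ψ(Y)` over `Y` to the model blow-up `B` of `V(z, x_S)`; a finite set of charts `Pc ⊆ S`, for each `m ∈ Pc` a re-centring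
`Θ_m` translating by `b` (`b|_S = 0`) and a centre `T_m ∋ m`; an ideal sheaf `Zm` on the model READING `𝓘Λ(T_m)` on every chart `m` and
COVERED by these charts; the model transform reading `(z^p + F_m)·𝒪` on chart `m`; the directions `D` (off `S`, inside every `T_m`) whose
values `b|_D` are fixed, with the parent's base-with-`D`-fixed `φ(ψ⁻¹(V(z, x_S) ∩ {x_i = b_i : i ∈ D}))` CLOSED in `Z`. CONCLUSION: the PULL
`c″` of `V(Zm)` through `ε` is closed in `W`, tested through `ε`, lies over that base, is non-empty, is COVERED by the zigzag charts of the
charts `m ∈ Pc`, and on chart `m` reads the transformed marked ideal as `(z^p + F_m)·𝒪`, itself as `𝓘Λ(T_m)`, the exceptional divisor as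
`x_m`, and sees `V(z, x_{T_m})`.

* `apply_mem_base_of_cover_readings` (model: `B(V(Zm)) ⊆ V(z, x_S) ∩ {x_D = b_D}`), **`atlas_child_of_charts`**.

AI-produced formalisation, weaker than expert review. bears_on: LADDER-RESOLUTION:D157-DOOR2 (res-dim4-pi · S3 (c) v4 A1-charts).
-/

set_option linter.dupNamespace false -- D-0017: single-problem summit path `Summit.<S>.<S>.…` by design

noncomputable section

open MvPolynomial Finset CategoryTheory AlgebraicGeometry Opposite TopologicalSpace
open AlgebraicGeometry.Scheme.IdealSheafData (ofIdealTop vanishingIdeal)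

namespace Summit.ResolutionOfSingularities.ResolutionOfSingularities.Theorems.PIDim4

open Literature.AlgebraicGeometry.Resolution
open Literature.AlgebraicGeometry.Resolution.AffinePointBlowup (P A γ coord Wtop ξ)

namespace Equimultiple

/-! ## §1 Model: the centre lies over the parent's base with the free directions fixed -/

section ModelBase

variable {K : Type} [Field K] {S : Finset (Fin 4)} {Bl : Scheme.{0}} {B : Bl ⟶ P 4 K}

/-- **A set covered by translated charts reading coordinate subspaces lies over the parent's base with the common directions fixed.**
Charts `Spec Θ_m ≫ chartImm_m` (`m ∈ Pc ⊆ S`, `Θ_m x_i = x_i + b_i`, `b|_S = 0`), a set `Zs ⊆ ⋃_m range` reading `V(z, x_{T_m})` on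
chart `m` with `m ∈ T_m` and `D ⊆ T_m`, `D ∩ S = ∅`: then `B(Zs) ⊆ V(z, x_S) ∩ {x_i = b_i : i ∈ D}`. (g6's A1f with the direction set made
a parameter.) [cite: BierstoneGrigorievMilmanWlodarczyk2011, §4 Step 2b] [cite: Hauser2010, §G (chart expressions)] -/
theorem apply_mem_base_of_cover_readings
    (hB : IsBlowup B (AffineCoordBlowup.𝓘Λ 4 K (insert 0 (Fin.succ '' (S : Set (Fin 4))))))
    (Pc : Finset (Fin 4)) (hP : ∀ m ∈ Pc, m ∈ S) (Θ : Fin 4 → (A 4 K ≃ₐ[K] A 4 K)) {b : Fin 4 → K}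
    (hΘ : ∀ m ∈ Pc, ∀ i : Fin 4, Θ m (X i.succ) = X i.succ + C (b i)) (hbS : ∀ i ∈ S, b i = 0)
    (Tm : Fin 4 → Finset (Fin 4)) (hTm : ∀ m ∈ Pc, m ∈ Tm m) (D : Finset (Fin 4)) (hD : ∀ i ∈ D, i ∉ S ∧ ∀ m ∈ Pc, i ∈ Tm m)
    (Zs : Set Bl)
    (hcov : Zs ⊆ ⋃ (m : Fin 4) (hm : m ∈ Pc), Set.range (Spec.map (CommRingCat.ofHom (Θ m : A 4 K →+* A 4 K)) ≫
      AffineCoordBlowup.chartImm hB (ChartDictionary.succ_mem_centreVars (hP m hm))))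
    (hread : ∀ m (hm : m ∈ Pc), Zs ∩ Set.range (Spec.map (CommRingCat.ofHom (Θ m : A 4 K →+* A 4 K)) ≫
        AffineCoordBlowup.chartImm hB (ChartDictionary.succ_mem_centreVars (hP m hm))) ⊆
      (Spec.map (CommRingCat.ofHom (Θ m : A 4 K →+* A 4 K)) ≫
        AffineCoordBlowup.chartImm hB (ChartDictionary.succ_mem_centreVars (hP m hm))) ''
        (AffineCoordBlowup.CΛ 4 K (insert 0 (Fin.succ '' (Tm m : Set (Fin 4)))) : Set (P 4 K)))
    {z : Bl} (hz : z ∈ Zs) :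
    B z ∈ {x : P 4 K | x ∈ (AffineCoordBlowup.CΛ 4 K (insert 0 (Fin.succ '' (S : Set (Fin 4)))) : Set (P 4 K)) ∧
      ∀ i ∈ D, (X i.succ - C (b i) : A 4 K) ∈ x.asIdeal} := by
  -- the chart that sees `z`, and the point `y ∈ V(z, x_{T_m})` it comes from
  obtain ⟨m, hm, hzm⟩ : ∃ m, ∃ hm : m ∈ Pc, z ∈ Set.range (Spec.map (CommRingCat.ofHom (Θ m : A 4 K →+* A 4 K)) ≫
      AffineCoordBlowup.chartImm hB (ChartDictionary.succ_mem_centreVars (hP m hm))) := by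
    simpa only [Set.mem_iUnion] using hcov hz
  obtain ⟨y, hy, rfl⟩ := hread m hm ⟨hz, hzm⟩
  have hy' := (AffineCoordBlowup.mem_CΛ_iff' 4 K _ y).mp hy
  have hXm : (X m.succ : A 4 K) ∈ y.asIdeal := hy' m.succ (ChartDictionary.succ_mem_centreVars (hTm m hm))
  have hs : ∀ k : Fin 4, (Θ m : A 4 K →+* A 4 K) (X k.succ) = X k.succ + C (b k) := fun k => hΘ m hm k
  have hbm : b m = 0 := hbS m (hP m hm)
  -- `B ∘ (Spec Θ_m ≫ chartImm_m) = Spec (Θ_m ∘ ψ_m)`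
  have hmem : ∀ f : A 4 K, f ∈ (B ((Spec.map (CommRingCat.ofHom (Θ m : A 4 K →+* A 4 K)) ≫
      AffineCoordBlowup.chartImm hB (ChartDictionary.succ_mem_centreVars (hP m hm))) y)).asIdeal ↔
      (Θ m : A 4 K →+* A 4 K) (coordBlowupSubst K (insert 0 (Fin.succ '' (S : Set (Fin 4)))) m.succ f) ∈ y.asIdeal := by
    intro f
    rw [← Scheme.Hom.comp_apply, ChartDictionary.chart_comp_eq_specMap hB (ChartDictionary.succ_mem_centreVars (hP m hm)),
      Spec.map_apply, PrimeSpectrum.comap_asIdeal, Ideal.mem_comap, CommRingCat.hom_ofHom, RingHom.comp_apply,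
      AlgHom.toRingHom_eq_coe, AlgHom.coe_toRingHom]
  refine ⟨?_, fun i hi => ?_⟩
  · -- over the parent `V(z, x_S)`
    rw [SetLike.mem_coe, AffineCoordBlowup.mem_CΛ_iff']
    rintro k (rfl | ⟨i, hi, rfl⟩)
    · rw [hmem, ChartDictionary.clean_subst_X_zero hbm hs]
      exact Ideal.mul_mem_right _ _ hXm
    · by_cases him : i = m
      · subst him
        rw [hmem, ChartDictionary.clean_subst_X_chart hbm hs]
        exact hXm
      · rw [hmem, ChartDictionary.clean_subst_X_fibre hbm hs hi him]
        exact Ideal.mul_mem_right _ _ hXm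
  · -- the free directions are fixed: `x_i = b_i`, `i ∈ D`
    obtain ⟨hiS, hiT⟩ := hD i hi
    have hC : (Θ m : A 4 K →+* A 4 K) (C (b i)) = C (b i) := (Θ m).commutes (b i)
    rw [hmem, map_sub, map_sub, ChartDictionary.clean_subst_X_base hs hiS, coordBlowupSubst_C, hC, add_sub_cancel_right]
    exact hy' i.succ (ChartDictionary.succ_mem_centreVars (hiT m hm))

end ModelBase

/-! ## §2 The transported centre -/

section ChildCharts

variable {K : Type} [Field K] {Z Y W Bl : Scheme.{0}} (φ : Y ⟶ Z) [IsOpenImmersion φ] (ψ : Y ⟶ P 4 K) [IsOpenImmersion ψ]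
  {π : W ⟶ Z} {B : Bl ⟶ P 4 K} {S : Finset (Fin 4)}
  (ε : (π ⁻¹ᵁ φ.opensRange : Scheme.{0}) ≅ (B ⁻¹ᵁ ψ.opensRange : Scheme.{0}))

/-- **THE ATLAS CHILD FROM CHARTWISE MODEL DATA.** See the module docstring. [cite: BierstoneGrigorievMilmanWlodarczyk2011, §4 Step 2b;
Def. 3.1.3 (2), (4)] [cite: Hauser2010, §G] [cite: StacksProject, Tag 01J7] -/
theorem atlas_child_of_charts [IsLocallyNoetherian Z] (Zc : Z.IdealSheafData)
    (hB : IsBlowup B (AffineCoordBlowup.𝓘Λ 4 K (insert 0 (Fin.succ '' (S : Set (Fin 4))))))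
    (hsq : ε.hom ≫ (B ∣_ ψ.opensRange) = (π ∣_ φ.opensRange) ≫ (φ.isoOpensRange.inv ≫ ψ.isoOpensRange.hom))
    (hC' : ((AffineCoordBlowup.𝓘Λ 4 K (insert 0 (Fin.succ '' (S : Set (Fin 4))))).comap ψ.opensRange.ι).comap
        (φ.isoOpensRange.inv ≫ ψ.isoOpensRange.hom) = Zc.comap φ.opensRange.ι)
    (M : MarkedIdeal Z) {p : ℕ} (hmult : M.mult = p) (F : MvPolynomial (Fin 4) K)
    (hKEY : ((controlledTransform B (AffineCoordBlowup.𝓘Λ 4 K (insert 0 (Fin.succ '' (S : Set (Fin 4)))))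
        (hypSheaf p F) p).comap (B ⁻¹ᵁ ψ.opensRange).ι).comap ε.hom =
      (controlledTransform π Zc M.ideal p).comap (π ⁻¹ᵁ φ.opensRange).ι)
    (hsee : (AffineCoordBlowup.CΛ 4 K (insert 0 (Fin.succ '' (S : Set (Fin 4)))) : Set (P 4 K)) ⊆ Set.range ψ)
    (Pc : Finset (Fin 4)) (hPc : ∀ m ∈ Pc, m ∈ S) (hPne : Pc.Nonempty)
    (Θ : Fin 4 → (A 4 K ≃ₐ[K] A 4 K)) {b : Fin 4 → K}
    (hΘ : ∀ m ∈ Pc, ∀ i : Fin 4, Θ m (X i.succ) = X i.succ + C (b i)) (hbS : ∀ i ∈ S, b i = 0)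
    (Tm : Fin 4 → Finset (Fin 4)) (hTm : ∀ m ∈ Pc, m ∈ Tm m)
    (D : Finset (Fin 4)) (hD : ∀ i ∈ D, i ∉ S ∧ ∀ m ∈ Pc, i ∈ Tm m)
    (hfib : IsClosed (φ '' (ψ ⁻¹' {x : P 4 K | x ∈ (AffineCoordBlowup.CΛ 4 K (insert 0 (Fin.succ '' (S : Set (Fin 4)))) : Set (P 4 K)) ∧
      ∀ i ∈ D, (X i.succ - C (b i) : A 4 K) ∈ x.asIdeal})))
    (Zm : Bl.IdealSheafData) (Fm : Fin 4 → MvPolynomial (Fin 4) K)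
    (hZread : ∀ m (hm : m ∈ Pc), Zm.comap (Spec.map (CommRingCat.ofHom (Θ m : A 4 K →+* A 4 K)) ≫
        AffineCoordBlowup.chartImm hB (ChartDictionary.succ_mem_centreVars (hPc m hm))) =
      AffineCoordBlowup.𝓘Λ 4 K (insert 0 (Fin.succ '' (Tm m : Set (Fin 4)))))
    (hMread : ∀ m (hm : m ∈ Pc),
      (controlledTransform B (AffineCoordBlowup.𝓘Λ 4 K (insert 0 (Fin.succ '' (S : Set (Fin 4))))) (hypSheaf p F) p).comap
        (Spec.map (CommRingCat.ofHom (Θ m : A 4 K →+* A 4 K)) ≫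
          AffineCoordBlowup.chartImm hB (ChartDictionary.succ_mem_centreVars (hPc m hm))) = hypSheaf p (Fm m))
    (hcov : (Zm.support : Set Bl) ⊆ ⋃ (m : Fin 4) (hm : m ∈ Pc),
      Set.range (Spec.map (CommRingCat.ofHom (Θ m : A 4 K →+* A 4 K)) ≫
        AffineCoordBlowup.chartImm hB (ChartDictionary.succ_mem_centreVars (hPc m hm)))) :
    ∃ c'' : Closeds W,
      -- membership through `ε`
      (∀ (w : W) (hwV : w ∈ π ⁻¹ᵁ φ.opensRange), w ∈ (c'' : Set W) ↔
        ((B ⁻¹ᵁ ψ.opensRange).ι (ε.hom ⟨w, hwV⟩) : Bl) ∈ (Zm.support : Set Bl)) ∧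
      -- over the parent's base with the free directions fixed
      (c'' : Set W) ⊆ π ⁻¹' (φ '' (ψ ⁻¹' {x : P 4 K | x ∈ (AffineCoordBlowup.CΛ 4 K (insert 0 (Fin.succ '' (S : Set (Fin 4)))) : Set (P 4 K)) ∧
        ∀ i ∈ D, (X i.succ - C (b i) : A 4 K) ∈ x.asIdeal})) ∧
      (c'' : Set W).Nonempty ∧
      -- covered by the zigzag charts of the charts
      ((c'' : Set W) ⊆ ⋃ (m : Fin 4) (hm : m ∈ Pc),
        Set.range (((Spec.map (CommRingCat.ofHom (Θ m : A 4 K →+* A 4 K)) ≫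
            AffineCoordBlowup.chartImm hB (ChartDictionary.succ_mem_centreVars (hPc m hm))) ∣_ (B ⁻¹ᵁ ψ.opensRange)) ≫
          ε.inv ≫ (π ⁻¹ᵁ φ.opensRange).ι)) ∧
      -- the chart readings
      ∀ (m : Fin 4) (hm : m ∈ Pc),
        (M.transform π Zc).ideal.comap
            (((Spec.map (CommRingCat.ofHom (Θ m : A 4 K →+* A 4 K)) ≫
                AffineCoordBlowup.chartImm hB (ChartDictionary.succ_mem_centreVars (hPc m hm))) ∣_ (B ⁻¹ᵁ ψ.opensRange)) ≫
              ε.inv ≫ (π ⁻¹ᵁ φ.opensRange).ι) =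
          (hypSheaf p (Fm m)).comap
            ((Spec.map (CommRingCat.ofHom (Θ m : A 4 K →+* A 4 K)) ≫
                AffineCoordBlowup.chartImm hB (ChartDictionary.succ_mem_centreVars (hPc m hm))) ⁻¹ᵁ (B ⁻¹ᵁ ψ.opensRange)).ι ∧
        (vanishingIdeal c'').comap
            (((Spec.map (CommRingCat.ofHom (Θ m : A 4 K →+* A 4 K)) ≫
                AffineCoordBlowup.chartImm hB (ChartDictionary.succ_mem_centreVars (hPc m hm))) ∣_ (B ⁻¹ᵁ ψ.opensRange)) ≫
              ε.inv ≫ (π ⁻¹ᵁ φ.opensRange).ι) =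
          (AffineCoordBlowup.𝓘Λ 4 K (insert 0 (Fin.succ '' (Tm m : Set (Fin 4))))).comap
            ((Spec.map (CommRingCat.ofHom (Θ m : A 4 K →+* A 4 K)) ≫
                AffineCoordBlowup.chartImm hB (ChartDictionary.succ_mem_centreVars (hPc m hm))) ⁻¹ᵁ (B ⁻¹ᵁ ψ.opensRange)).ι ∧
        (Zc.comap π).comap
            (((Spec.map (CommRingCat.ofHom (Θ m : A 4 K →+* A 4 K)) ≫
                AffineCoordBlowup.chartImm hB (ChartDictionary.succ_mem_centreVars (hPc m hm))) ∣_ (B ⁻¹ᵁ ψ.opensRange)) ≫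
              ε.inv ≫ (π ⁻¹ᵁ φ.opensRange).ι) =
          (ofIdealTop (Ideal.span {coord 4 K m.succ})).comap
            ((Spec.map (CommRingCat.ofHom (Θ m : A 4 K →+* A 4 K)) ≫
                AffineCoordBlowup.chartImm hB (ChartDictionary.succ_mem_centreVars (hPc m hm))) ⁻¹ᵁ (B ⁻¹ᵁ ψ.opensRange)).ι ∧
        (AffineCoordBlowup.CΛ 4 K (insert 0 (Fin.succ '' (Tm m : Set (Fin 4)))) : Set (P 4 K)) ⊆
          Set.range ((Spec.map (CommRingCat.ofHom (Θ m : A 4 K →+* A 4 K)) ≫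
                AffineCoordBlowup.chartImm hB (ChartDictionary.succ_mem_centreVars (hPc m hm))) ⁻¹ᵁ (B ⁻¹ᵁ ψ.opensRange)).ι := by
  classical
  haveI : IsProper B := hB.isProper
  haveI : IsLocallyNoetherian Bl := LocallyOfFiniteType.isLocallyNoetherian B
  -- the chart points of the model centre lie in `V(z, x_{T_m})`
  have hread' : ∀ m (hm : m ∈ Pc), (Zm.support : Set Bl) ∩
      Set.range (Spec.map (CommRingCat.ofHom (Θ m : A 4 K →+* A 4 K)) ≫
        AffineCoordBlowup.chartImm hB (ChartDictionary.succ_mem_centreVars (hPc m hm))) ⊆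
      (Spec.map (CommRingCat.ofHom (Θ m : A 4 K →+* A 4 K)) ≫
        AffineCoordBlowup.chartImm hB (ChartDictionary.succ_mem_centreVars (hPc m hm))) ''
        (AffineCoordBlowup.CΛ 4 K (insert 0 (Fin.succ '' (Tm m : Set (Fin 4)))) : Set (P 4 K)) := by
    rintro m hm z ⟨hz, y, rfl⟩
    refine ⟨y, ?_, rfl⟩
    have h1 : y ∈ (Zm.comap (Spec.map (CommRingCat.ofHom (Θ m : A 4 K →+* A 4 K)) ≫
        AffineCoordBlowup.chartImm hB (ChartDictionary.succ_mem_centreVars (hPc m hm)))).support := by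
      rw [Scheme.IdealSheafData.support_comap]; exact hz
    rw [hZread m hm, AffineCoordBlowup.support_𝓘Λ] at h1
    exact h1
  -- chart points of `V(z, x_{T_m})` are points of the model centre
  have hmemZ : ∀ m (hm : m ∈ Pc) (y : P 4 K),
      y ∈ (AffineCoordBlowup.CΛ 4 K (insert 0 (Fin.succ '' (Tm m : Set (Fin 4)))) : Set (P 4 K)) →
      (Spec.map (CommRingCat.ofHom (Θ m : A 4 K →+* A 4 K)) ≫
        AffineCoordBlowup.chartImm hB (ChartDictionary.succ_mem_centreVars (hPc m hm))) y ∈ (Zm.support : Set Bl) := by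
    intro m hm y hy
    have h1 : y ∈ ((Zm.comap (Spec.map (CommRingCat.ofHom (Θ m : A 4 K →+* A 4 K)) ≫
        AffineCoordBlowup.chartImm hB (ChartDictionary.succ_mem_centreVars (hPc m hm)))).support : Set (P 4 K)) := by
      rw [hZread m hm, AffineCoordBlowup.support_𝓘Λ]; exact hy
    rw [Scheme.IdealSheafData.support_comap] at h1
    exact h1
  -- (3a) the model centre lies over the parent's base with the free directions fixed
  have hbase : ∀ z ∈ (Zm.support : Set Bl), B z ∈ {x : P 4 K |
      x ∈ (AffineCoordBlowup.CΛ 4 K (insert 0 (Fin.succ '' (S : Set (Fin 4)))) : Set (P 4 K)) ∧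
        ∀ i ∈ D, (X i.succ - C (b i) : A 4 K) ∈ x.asIdeal} := fun z hz =>
    apply_mem_base_of_cover_readings hB Pc hPc Θ hΘ hbS Tm hTm D hD (Zm.support : Set Bl) hcov hread' hz
  have hbaseCΛ : ∀ z ∈ (Zm.support : Set Bl),
      B z ∈ (AffineCoordBlowup.CΛ 4 K (insert 0 (Fin.succ '' (S : Set (Fin 4)))) : Set (P 4 K)) :=
    fun z hz => (hbase z hz).1
  -- (3b) the child: the PULL of the model centre, closed in `W`
  set cset : Set W := (π ⁻¹ᵁ φ.opensRange).ι ''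
    ((ε.hom : (π ⁻¹ᵁ φ.opensRange : Scheme.{0}) → (B ⁻¹ᵁ ψ.opensRange : Scheme.{0})) ⁻¹'
      (((B ⁻¹ᵁ ψ.opensRange).ι : (B ⁻¹ᵁ ψ.opensRange : Scheme.{0}) → Bl) ⁻¹' (Zm.support : Set Bl))) with hcset
  have hclosed : IsClosed cset := by
    have h1 := zigzag_transport_isClosed' φ ψ ε Zm.subschemeι hsq Set.univ _
      (by rw [Set.image_univ, Scheme.IdealSheafData.range_subschemeι]; exact Zm.support.isClosed) hfib
      (fun y _ => hbase _ (by rw [← Scheme.IdealSheafData.range_subschemeι]; exact ⟨y, rfl⟩))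
    rw [zigzag_transport_image_eq_pull φ ψ ε Zm.subschemeι Set.univ, Set.image_univ, Scheme.IdealSheafData.range_subschemeι] at h1
    exact h1
  set c'' : Closeds W := ⟨cset, hclosed⟩ with hc''
  -- membership through `ε`
  have hmemε : ∀ (w : W) (hwV : w ∈ π ⁻¹ᵁ φ.opensRange), w ∈ (c'' : Set W) ↔
      ((B ⁻¹ᵁ ψ.opensRange).ι (ε.hom ⟨w, hwV⟩) : Bl) ∈ (Zm.support : Set Bl) := by
    intro w hwV
    change w ∈ cset ↔ _
    constructor
    · rintro ⟨q, hq, hqw⟩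
      have : q = ⟨w, hwV⟩ := Subtype.ext hqw
      subst this
      exact hq
    · intro hw
      exact ⟨⟨w, hwV⟩, hw, rfl⟩
  -- every point of the child is a zigzag-chart point of some chart `m`
  have hchart : ∀ w ∈ (c'' : Set W), ∃ (m : Fin 4) (hm : m ∈ Pc)
      (y : ((Spec.map (CommRingCat.ofHom (Θ m : A 4 K →+* A 4 K)) ≫
        AffineCoordBlowup.chartImm hB (ChartDictionary.succ_mem_centreVars (hPc m hm))) ⁻¹ᵁ
          (B ⁻¹ᵁ ψ.opensRange) : Scheme.{0})),
      y.1 ∈ (AffineCoordBlowup.CΛ 4 K (insert 0 (Fin.succ '' (Tm m : Set (Fin 4)))) : Set (P 4 K)) ∧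
      (((Spec.map (CommRingCat.ofHom (Θ m : A 4 K →+* A 4 K)) ≫
          AffineCoordBlowup.chartImm hB (ChartDictionary.succ_mem_centreVars (hPc m hm))) ∣_
          (B ⁻¹ᵁ ψ.opensRange)) ≫ ε.inv ≫ (π ⁻¹ᵁ φ.opensRange).ι) y = w := by
    rintro w ⟨q, hq, rfl⟩
    obtain ⟨m, hm, hzm⟩ := Set.mem_iUnion₂.mp (hcov hq)
    obtain ⟨y, hy, hyz⟩ := hread' m hm ⟨hq, hzm⟩
    have hyO : y ∈ (Spec.map (CommRingCat.ofHom (Θ m : A 4 K →+* A 4 K)) ≫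
        AffineCoordBlowup.chartImm hB (ChartDictionary.succ_mem_centreVars (hPc m hm))) ⁻¹ᵁ (B ⁻¹ᵁ ψ.opensRange) := by
      change (Spec.map (CommRingCat.ofHom (Θ m : A 4 K →+* A 4 K)) ≫
        AffineCoordBlowup.chartImm hB (ChartDictionary.succ_mem_centreVars (hPc m hm))) y ∈ B ⁻¹ᵁ ψ.opensRange
      rw [hyz]
      exact (ε.hom q).2
    refine ⟨m, hm, ⟨y, hyO⟩, hy, ?_⟩
    have h1 : ((Spec.map (CommRingCat.ofHom (Θ m : A 4 K →+* A 4 K)) ≫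
        AffineCoordBlowup.chartImm hB (ChartDictionary.succ_mem_centreVars (hPc m hm))) ∣_
        (B ⁻¹ᵁ ψ.opensRange)) ⟨y, hyO⟩ = ε.hom q := by
      apply Subtype.ext
      rw [morphismRestrict_base_coe]
      exact hyz
    rw [Scheme.Hom.comp_apply, Scheme.Hom.comp_apply, h1, ← Scheme.Hom.comp_apply ε.hom ε.inv, Iso.hom_inv_id]
    rfl
  -- the charts see their centres
  have hseen : ∀ m (hm : m ∈ Pc), (AffineCoordBlowup.CΛ 4 K (insert 0 (Fin.succ '' (Tm m : Set (Fin 4)))) : Set (P 4 K)) ⊆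
      Set.range ((Spec.map (CommRingCat.ofHom (Θ m : A 4 K →+* A 4 K)) ≫
        AffineCoordBlowup.chartImm hB (ChartDictionary.succ_mem_centreVars (hPc m hm))) ⁻¹ᵁ (B ⁻¹ᵁ ψ.opensRange)).ι :=
    fun m hm => ChartDictionary.zigzag_transport_range ψ _ _ fun y hy => hsee (hbaseCΛ _ (hmemZ m hm y hy))
  refine ⟨c'', hmemε, ?_, ?_, ?_, fun m hm => ⟨?_, ?_, ?_, hseen m hm⟩⟩
  · -- over the parent's base
    intro w hw
    obtain ⟨m, hm, y, hy, rfl⟩ := hchart w hw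
    obtain ⟨hπy, hψy⟩ := ChartDictionary.zigzag_transport_π_apply φ ψ ε _ hsq y
    rw [Set.mem_preimage, hπy]
    refine ⟨_, ?_, rfl⟩
    rw [Set.mem_preimage, hψy]
    exact hbase _ (hmemZ m hm y.1 hy)
  · -- non-empty: the point over the origin of any chart
    obtain ⟨m, hm⟩ := hPne
    have hξ : (ξ 4 K) ∈ (AffineCoordBlowup.CΛ 4 K (insert 0 (Fin.succ '' (Tm m : Set (Fin 4)))) : Set (P 4 K)) := by
      rw [SetLike.mem_coe, AffineCoordBlowup.mem_CΛ_iff']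
      intro i _
      exact (mem_originIdeal_iff K (4 + 1)).mpr (constantCoeff_X K i)
    obtain ⟨y₀, hy₀⟩ := hseen m hm hξ
    refine ⟨(((Spec.map (CommRingCat.ofHom (Θ m : A 4 K →+* A 4 K)) ≫
        AffineCoordBlowup.chartImm hB (ChartDictionary.succ_mem_centreVars (hPc m hm))) ∣_
        (B ⁻¹ᵁ ψ.opensRange)) ≫ ε.inv ≫ (π ⁻¹ᵁ φ.opensRange).ι) y₀, ?_⟩
    have hy₀' : y₀.1 = ξ 4 K := hy₀
    have h5 : ε.hom (ε.inv (((Spec.map (CommRingCat.ofHom (Θ m : A 4 K →+* A 4 K)) ≫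
        AffineCoordBlowup.chartImm hB (ChartDictionary.succ_mem_centreVars (hPc m hm))) ∣_
        (B ⁻¹ᵁ ψ.opensRange)) y₀)) =
        ((Spec.map (CommRingCat.ofHom (Θ m : A 4 K →+* A 4 K)) ≫
          AffineCoordBlowup.chartImm hB (ChartDictionary.succ_mem_centreVars (hPc m hm))) ∣_
          (B ⁻¹ᵁ ψ.opensRange)) y₀ := by
      rw [← Scheme.Hom.comp_apply, Iso.inv_hom_id]; rfl
    rw [Scheme.Hom.comp_apply, Scheme.Hom.comp_apply, Scheme.Opens.ι_apply, hmemε _ (ε.inv _).2, Subtype.coe_eta, h5,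
      Scheme.Opens.ι_apply, morphismRestrict_base_coe, hy₀']
    exact hmemZ m hm _ hξ
  · -- the cover
    intro w hw
    obtain ⟨m, hm, y, -, rfl⟩ := hchart w hw
    exact Set.mem_iUnion₂.mpr ⟨m, hm, y, rfl⟩
  · -- the reading of the transformed marked ideal
    rw [MarkedIdeal.transform_ideal, hmult, ChartDictionary.zigzag_transport_comap φ ψ ε _ _ _ hKEY, hMread m hm]
  · -- the reading of the child
    haveI := isOpenImmersion_specMap_algEquiv (Θ m)
    rw [comap_vanishingIdeal_of_isOpenImmersion]
    have hrad := ChartDictionary.radical_comap_𝓘Λ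
      (((Spec.map (CommRingCat.ofHom (Θ m : A 4 K →+* A 4 K)) ≫
        AffineCoordBlowup.chartImm hB (ChartDictionary.succ_mem_centreVars (hPc m hm))) ⁻¹ᵁ (B ⁻¹ᵁ ψ.opensRange)).ι)
      (insert 0 (Fin.succ '' (Tm m : Set (Fin 4))))
    rw [eq_vanishingIdeal_support hrad]
    congr 1
    apply TopologicalSpace.Closeds.ext
    rw [ChartDictionary.coe_support_comap_𝓘Λ]
    ext y
    have hιy : (((Spec.map (CommRingCat.ofHom (Θ m : A 4 K →+* A 4 K)) ≫
        AffineCoordBlowup.chartImm hB (ChartDictionary.succ_mem_centreVars (hPc m hm))) ∣_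
        (B ⁻¹ᵁ ψ.opensRange)) ≫ ε.inv ≫ (π ⁻¹ᵁ φ.opensRange).ι) y =
        (π ⁻¹ᵁ φ.opensRange).ι (ε.inv (((Spec.map (CommRingCat.ofHom (Θ m : A 4 K →+* A 4 K)) ≫
          AffineCoordBlowup.chartImm hB (ChartDictionary.succ_mem_centreVars (hPc m hm))) ∣_
          (B ⁻¹ᵁ ψ.opensRange)) y)) := by
      simp only [Scheme.Hom.comp_apply]
    have h5' : ε.hom (ε.inv (((Spec.map (CommRingCat.ofHom (Θ m : A 4 K →+* A 4 K)) ≫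
        AffineCoordBlowup.chartImm hB (ChartDictionary.succ_mem_centreVars (hPc m hm))) ∣_
        (B ⁻¹ᵁ ψ.opensRange)) y)) =
        ((Spec.map (CommRingCat.ofHom (Θ m : A 4 K →+* A 4 K)) ≫
          AffineCoordBlowup.chartImm hB (ChartDictionary.succ_mem_centreVars (hPc m hm))) ∣_
          (B ⁻¹ᵁ ψ.opensRange)) y := by
      rw [← Scheme.Hom.comp_apply, Iso.inv_hom_id]; rfl
    have h4 : y.1 ∈ ((Zm.comap (Spec.map (CommRingCat.ofHom (Θ m : A 4 K →+* A 4 K)) ≫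
        AffineCoordBlowup.chartImm hB (ChartDictionary.succ_mem_centreVars (hPc m hm)))).support : Set (P 4 K)) ↔
        y.1 ∈ (AffineCoordBlowup.CΛ 4 K (insert 0 (Fin.succ '' (Tm m : Set (Fin 4)))) : Set (P 4 K)) := by
      rw [hZread m hm, AffineCoordBlowup.support_𝓘Λ]
    rw [Scheme.IdealSheafData.support_comap] at h4
    change (((Spec.map (CommRingCat.ofHom (Θ m : A 4 K →+* A 4 K)) ≫
        AffineCoordBlowup.chartImm hB (ChartDictionary.succ_mem_centreVars (hPc m hm))) ∣_
        (B ⁻¹ᵁ ψ.opensRange)) ≫ ε.inv ≫ (π ⁻¹ᵁ φ.opensRange).ι) y ∈ (c'' : Set W) ↔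
      y ∈ ((Spec.map (CommRingCat.ofHom (Θ m : A 4 K →+* A 4 K)) ≫
        AffineCoordBlowup.chartImm hB (ChartDictionary.succ_mem_centreVars (hPc m hm))) ⁻¹ᵁ
          (B ⁻¹ᵁ ψ.opensRange)).ι ⁻¹'
        (AffineCoordBlowup.CΛ 4 K (insert 0 (Fin.succ '' (Tm m : Set (Fin 4)))) : Set (P 4 K))
    rw [hιy, Scheme.Opens.ι_apply, hmemε _ (ε.inv _).2, Subtype.coe_eta, h5', Scheme.Opens.ι_apply, morphismRestrict_base_coe,
      Set.mem_preimage, Scheme.Opens.ι_apply]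
    exact h4
  · -- the exceptional divisor
    have hΘmm : (Θ m : A 4 K →+* A 4 K) (X m.succ) = X m.succ := by
      change Θ m (X m.succ) = X m.succ
      rw [hΘ m hm m, hbS m (hPc m hm), C_0, add_zero]
    rw [ChartDictionary.zigzag_transport_comap φ ψ ε _ _ _ (ChartDictionary.zigzag_transport_centre φ ψ ε _ _ hsq hC'),
      ChartDictionary.comap_exceptional_chart (hPc m hm) hΘmm hB]

end ChildCharts

end Equimultiple

end Summit.ResolutionOfSingularities.ResolutionOfSingularities.Theorems.PIDim4

end
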